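import Summits.MatrixMultiplication.MatrixMultiplication.Theses.LevelGradedCohnUmans
import Summits.MatrixMultiplication.MatrixMultiplication.Theorems.GradedPricing.Negative.LoadBearing
import Summits.MatrixMultiplication.MatrixMultiplication.Theorems.GradedPricing.Negative.AbelianHosts
import Literature.RepresentationTheory.FiniteGroups.IrreducibleCharacters
import Literature.RepresentationTheory.FiniteGroups.NumberOfIrreducibles
import Literature.RepresentationTheory.FiniteGroups.BrauerTheorem

/-!
# `GradedDesignFamily` (crux `stmt-MatrixMultiplication-7610`, route `LevelGradedCohnUmans`):
# load-bearing constraints and the range of `ε` (negative-side support)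

Support file of the crux disprover (cdisprove seat, cycle 1); everything `sorry`-free.  The crux
asks, for every `ε > 0`, for a finite group `G`, a BI-INVARIANT `J ≤ ℂ^G` and a `J`-SEPARATED
triple `X, Y, Z` with `Σᶠ_{χ ∈ Irr(G) ∩ J} χ(1)^(2+ε) < (|X||Y||Z|)^((2+ε)/3)`.  Proved here:

* each constraint is LOAD-BEARING — drop it and the family is TRIVIALLY realizable in `Z/2` at
  every `ε`: `realizable_without_biInv` (`J = ℂ·δ_g`: budget `0 < 1`), `realizable_without_zeros`
  (drop "`f = 0` off the pattern": `J` = constants, `X = G`: `1 < 2^((2+ε)/3)`),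
  `realizable_without_ones` (drop "`f = 1` on the pattern": `J = ⊥`: `0 < 1`), `realizable_with_le`
  (`≤` for `<`: `1 ≤ 1`) — so any use of the crux needs bi-invariance, both pattern halves and
  strictness (the route's Assembly consumes exactly the strict inequality);
* THE RANGE OF `ε`: `gradedBudget_le_card_of_comm` (abelian budget `≤ |G|`), `witness_of_one_lt` —
  for every `ε > 1` the trivial `Z/2` matrix–vector design `X = G`, `Y = Z = {1}`, `J = ℂ^G`
  (budget `2`, volume `2`) IS a witness; with the sibling disprover's
  `gradedDesignFamily_no_abelian_witness` (crux 7611: no abelian witness at `0 < ε ≤ 1`) this is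
  `exists_abelian_witness_iff`: ABELIAN HOSTS REALIZE `ε` IFF `ε > 1`.  The whole content of the
  crux is the range `0 < ε ≤ 1`, where hosts must be non-abelian.
-/

noncomputable section

set_option linter.dupNamespace false

open scoped BigOperators
open Module Literature.RepresentationTheory.FiniteGroups

namespace Summit.MatrixMultiplication.MatrixMultiplication.Theorems.GradedDesignFamily.Negative

/-! ## Dropping a constraint trivializes the family -/

/-- **Bi-invariance is load-bearing**: WITHOUT it the family is trivially realizable at every
`ε`: `G = Z/2`, `J = ℂ·δ_g`, `X = Y = {1}`, `Z = {g}`; `δ_g` separates, no irreducible character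
lies in `ℂ·δ_g`, budget `0 < 1 = V^((2+ε)/3)`. [folklore] -/
theorem realizable_without_biInv (ε : ℝ) :
    ∃ (G : Type) (_ : Group G) (_ : Fintype G) (J : Submodule ℂ (G → ℂ)) (X Y Z : Finset G),
      (∀ x₀ ∈ X, ∀ z₀ ∈ Z, ∃ f ∈ J, ∀ x ∈ X, ∀ y ∈ Y, ∀ y' ∈ Y, ∀ z ∈ Z,
        (x = x₀ ∧ y = y' ∧ z = z₀ → f (x⁻¹ * y * y'⁻¹ * z) = 1) ∧
        (¬ (x = x₀ ∧ y = y' ∧ z = z₀) → f (x⁻¹ * y * y'⁻¹ * z) = 0)) ∧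
      (∑ᶠ χ ∈ irrChars G ∩ (J : Set (G → ℂ)), (χ 1).re ^ (2 + ε))
        < ((X.card * Y.card * Z.card : ℕ) : ℝ) ^ ((2 + ε) / 3) := by
  refine ⟨Multiplicative (ZMod 2), inferInstance, inferInstance,
    Submodule.span ℂ {(Pi.single (Multiplicative.ofAdd (1 : ZMod 2)) (1 : ℂ) : _ → ℂ)},
    {1}, {1}, {Multiplicative.ofAdd (1 : ZMod 2)}, ?_, ?_⟩
  · intro x₀ hx₀ z₀ hz₀
    refine ⟨Pi.single (Multiplicative.ofAdd (1 : ZMod 2)) 1, Submodule.subset_span rfl, ?_⟩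
    intro x hx y hy y' hy' z hz
    simp only [Finset.mem_singleton] at hx hy hy' hz hx₀ hz₀
    subst hx hy hy' hz hx₀ hz₀
    exact ⟨fun _ => by simp, fun hne => absurd ⟨rfl, rfl, rfl⟩ hne⟩
  · rw [GradedPricing.Negative.irrChars_inter_span_single GradedPricing.Negative.ofAdd_one_ne_one,
      finsum_mem_empty]
    simp

/-- **"`f = 0` off the pattern" is load-bearing** (this half carries the TPP): WITHOUT it the
family is trivially realizable at every `ε > 0`: `G = Z/2`, `J` = constants (bi-invariant,
budget `1`), `f = 1`, `X = G`, `Y = Z = {1}`, `V = 2`, `1 < 2^((2+ε)/3)`. [folklore] -/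
theorem realizable_without_zeros (ε : ℝ) (hε : 0 < ε) :
    ∃ (G : Type) (_ : Group G) (_ : Fintype G) (J : Submodule ℂ (G → ℂ)) (X Y Z : Finset G),
      (∀ f ∈ J, ∀ a b : G, (fun g : G => f (a * g * b)) ∈ J) ∧
      (∀ x₀ ∈ X, ∀ z₀ ∈ Z, ∃ f ∈ J, ∀ x ∈ X, ∀ y ∈ Y, ∀ y' ∈ Y, ∀ z ∈ Z,
        (x = x₀ ∧ y = y' ∧ z = z₀ → f (x⁻¹ * y * y'⁻¹ * z) = 1)) ∧
      (∑ᶠ χ ∈ irrChars G ∩ (J : Set (G → ℂ)), (χ 1).re ^ (2 + ε))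
        < ((X.card * Y.card * Z.card : ℕ) : ℝ) ^ ((2 + ε) / 3) := by
  refine ⟨Multiplicative (ZMod 2), inferInstance, inferInstance,
    Submodule.span ℂ {(1 : Multiplicative (ZMod 2) → ℂ)}, Finset.univ, {1}, {1}, ?_, ?_, ?_⟩
  · intro f hf a b
    obtain ⟨c, rfl⟩ := Submodule.mem_span_singleton.mp hf
    exact Submodule.mem_span_singleton.mpr ⟨c, by funext g; simp⟩
  · exact fun x₀ _ z₀ _ => ⟨1, Submodule.subset_span rfl, fun x _ y _ y' _ z _ _ => rfl⟩
  · rw [GradedPricing.Negative.irrChars_inter_span_one, finsum_mem_singleton]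
    have h2 : (Finset.univ : Finset (Multiplicative (ZMod 2))).card = 2 := by simp
    rw [h2]
    simp only [Pi.one_apply, Complex.one_re, Real.one_rpow, Finset.card_singleton, mul_one,
      Nat.cast_ofNat]
    exact Real.one_lt_rpow one_lt_two (by linarith)

/-- **"`f = 1` on the pattern" is load-bearing**: WITHOUT it the family is trivially realizable
at every `ε`: `J = ⊥`, `f = 0`, `X = Y = Z = {1}`: budget `0 < 1`. [folklore] -/
theorem realizable_without_ones (ε : ℝ) :
    ∃ (G : Type) (_ : Group G) (_ : Fintype G) (J : Submodule ℂ (G → ℂ)) (X Y Z : Finset G),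
      (∀ f ∈ J, ∀ a b : G, (fun g : G => f (a * g * b)) ∈ J) ∧
      (∀ x₀ ∈ X, ∀ z₀ ∈ Z, ∃ f ∈ J, ∀ x ∈ X, ∀ y ∈ Y, ∀ y' ∈ Y, ∀ z ∈ Z,
        (¬ (x = x₀ ∧ y = y' ∧ z = z₀) → f (x⁻¹ * y * y'⁻¹ * z) = 0)) ∧
      (∑ᶠ χ ∈ irrChars G ∩ (J : Set (G → ℂ)), (χ 1).re ^ (2 + ε))
        < ((X.card * Y.card * Z.card : ℕ) : ℝ) ^ ((2 + ε) / 3) := by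
  refine ⟨Multiplicative (ZMod 2), inferInstance, inferInstance, ⊥, {1}, {1}, {1}, ?_, ?_, ?_⟩
  · intro f hf a b
    rw [Submodule.mem_bot] at hf ⊢
    subst hf
    rfl
  · exact fun x₀ _ z₀ _ => ⟨0, Submodule.zero_mem _, fun x _ y _ y' _ z _ _ => rfl⟩
  · rw [GradedPricing.Negative.irrChars_inter_bot, finsum_mem_empty]
    simp

/-- **Strictness is load-bearing**: with `≤` in place of `<` the family is trivially realizable
at every `ε`: `G = Z/2`, `J` = constants, `X = Y = Z = {1}`: `1 ≤ 1`. [folklore] -/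
theorem realizable_with_le (ε : ℝ) :
    ∃ (G : Type) (_ : Group G) (_ : Fintype G) (J : Submodule ℂ (G → ℂ)) (X Y Z : Finset G),
      (∀ f ∈ J, ∀ a b : G, (fun g : G => f (a * g * b)) ∈ J) ∧
      (∀ x₀ ∈ X, ∀ z₀ ∈ Z, ∃ f ∈ J, ∀ x ∈ X, ∀ y ∈ Y, ∀ y' ∈ Y, ∀ z ∈ Z,
        (x = x₀ ∧ y = y' ∧ z = z₀ → f (x⁻¹ * y * y'⁻¹ * z) = 1) ∧
        (¬ (x = x₀ ∧ y = y' ∧ z = z₀) → f (x⁻¹ * y * y'⁻¹ * z) = 0)) ∧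
      (∑ᶠ χ ∈ irrChars G ∩ (J : Set (G → ℂ)), (χ 1).re ^ (2 + ε))
        ≤ ((X.card * Y.card * Z.card : ℕ) : ℝ) ^ ((2 + ε) / 3) := by
  refine ⟨Multiplicative (ZMod 2), inferInstance, inferInstance,
    Submodule.span ℂ {(1 : Multiplicative (ZMod 2) → ℂ)}, {1}, {1}, {1}, ?_, ?_, ?_⟩
  · intro f hf a b
    obtain ⟨c, rfl⟩ := Submodule.mem_span_singleton.mp hf
    exact Submodule.mem_span_singleton.mpr ⟨c, by funext g; simp⟩
  · intro x₀ hx₀ z₀ hz₀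
    refine ⟨1, Submodule.subset_span rfl, ?_⟩
    intro x hx y hy y' hy' z hz
    simp only [Finset.mem_singleton] at hx hy hy' hz hx₀ hz₀
    subst hx hy hy' hz hx₀ hz₀
    exact ⟨fun _ => rfl, fun hne => absurd ⟨rfl, rfl, rfl⟩ hne⟩
  · rw [GradedPricing.Negative.irrChars_inter_span_one, finsum_mem_singleton]
    simp

/-! ## The range of `ε`: abelian hosts realize the family exactly for `ε > 1` -/

/-- In a finite ABELIAN host the graded budget at any exponent is the NUMBER of characters in
`J`, hence at most the number of conjugacy classes, hence at most `|G|`. [folklore] -/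
theorem gradedBudget_le_card_of_comm {G : Type} [CommGroup G] [Fintype G]
    (J : Submodule ℂ (G → ℂ)) (s : ℝ) :
    (∑ᶠ χ ∈ irrChars G ∩ (J : Set (G → ℂ)), (χ 1).re ^ s) ≤ Nat.card G := by
  rw [GradedPricing.Negative.gradedBudget_eq_card_of_comm J s]
  have h1 : (GradedPricing.Negative.irrChars_inter_finite' J).toFinset.card
      = (irrChars G ∩ (J : Set (G → ℂ))).ncard :=
    (Set.ncard_eq_toFinset_card _ (GradedPricing.Negative.irrChars_inter_finite' J)).symm
  have h2 : (irrChars G ∩ (J : Set (G → ℂ))).ncard ≤ (irrChars G).ncard :=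
    Set.ncard_le_ncard Set.inter_subset_left (irrChars_finite_holds G)
  have h3 : (irrChars G).ncard ≤ Nat.card G := by
    rw [ncard_irrChars_eq_card_conjClasses]
    exact Nat.card_le_card_of_surjective _ ConjClasses.mk_surjective
  exact_mod_cast h1.le.trans (h2.trans h3)

/-- **Every `ε > 1` is trivially realized**: the `Z/2` matrix–vector design `X = G`,
`Y = Z = {1}`, `J = ℂ^G` (budget `= #Irr(Z/2) = 2`, volume `2`, `2 < 2^((2+ε)/3)` iff `ε > 1`)
satisfies bi-invariance, separation (by `δ_{x₀⁻¹}`) and the strict inequality. [folklore] -/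
theorem witnessC2_of_one_lt {ε : ℝ} (hε : 1 < ε) :
    (∀ f ∈ (⊤ : Submodule ℂ (Multiplicative (ZMod 2) → ℂ)), ∀ a b : Multiplicative (ZMod 2),
      (fun g => f (a * g * b)) ∈ (⊤ : Submodule ℂ (Multiplicative (ZMod 2) → ℂ))) ∧
    (∀ x₀ ∈ (Finset.univ : Finset (Multiplicative (ZMod 2))),
      ∀ z₀ ∈ ({1} : Finset (Multiplicative (ZMod 2))),
      ∃ f ∈ (⊤ : Submodule ℂ (Multiplicative (ZMod 2) → ℂ)),
      ∀ x ∈ (Finset.univ : Finset (Multiplicative (ZMod 2))),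
      ∀ y ∈ ({1} : Finset (Multiplicative (ZMod 2))), ∀ y' ∈ ({1} : Finset (Multiplicative (ZMod 2))),
      ∀ z ∈ ({1} : Finset (Multiplicative (ZMod 2))),
        (x = x₀ ∧ y = y' ∧ z = z₀ → f (x⁻¹ * y * y'⁻¹ * z) = 1) ∧
        (¬ (x = x₀ ∧ y = y' ∧ z = z₀) → f (x⁻¹ * y * y'⁻¹ * z) = 0)) ∧
    (∑ᶠ χ ∈ irrChars (Multiplicative (ZMod 2)) ∩
        ((⊤ : Submodule ℂ (Multiplicative (ZMod 2) → ℂ)) : Set (Multiplicative (ZMod 2) → ℂ)),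
        (χ 1).re ^ (2 + ε))
      < (((Finset.univ : Finset (Multiplicative (ZMod 2))).card *
          ({1} : Finset (Multiplicative (ZMod 2))).card *
          ({1} : Finset (Multiplicative (ZMod 2))).card : ℕ) : ℝ) ^ ((2 + ε) / 3) := by
  refine ⟨fun f _ a b => Submodule.mem_top, ?_, ?_⟩
  · intro x₀ hx₀ z₀ hz₀
    refine ⟨Pi.single x₀⁻¹ 1, Submodule.mem_top, ?_⟩
    intro x hx y hy y' hy' z hz
    simp only [Finset.mem_singleton] at hy hy' hz hz₀
    subst hy hy' hz hz₀
    refine ⟨?_, ?_⟩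
    · rintro ⟨rfl, -, -⟩
      simp
    · intro hne
      have hx' : x ≠ x₀ := fun h => hne ⟨h, rfl, rfl⟩
      have : x⁻¹ ≠ x₀⁻¹ := fun h => hx' (inv_injective h)
      simp [this]
  · have hb : (∑ᶠ χ ∈ irrChars (Multiplicative (ZMod 2)) ∩
        ((⊤ : Submodule ℂ (Multiplicative (ZMod 2) → ℂ)) : Set (Multiplicative (ZMod 2) → ℂ)),
        (χ 1).re ^ (2 + ε)) ≤ 2 := by
      have := gradedBudget_le_card_of_comm (G := Multiplicative (ZMod 2)) ⊤ (2 + ε)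
      simpa using this
    have h2 : (Finset.univ : Finset (Multiplicative (ZMod 2))).card = 2 := by simp
    rw [h2]
    simp only [Finset.card_singleton, mul_one, Nat.cast_ofNat]
    calc _ ≤ (2 : ℝ) := hb
      _ = (2 : ℝ) ^ (1 : ℝ) := (Real.rpow_one 2).symm
      _ < (2 : ℝ) ^ ((2 + ε) / 3) := Real.rpow_lt_rpow_of_exponent_lt one_lt_two (by linarith)

/-- **The family is realized at every `ε > 1`** (by the trivial `Z/2` design) — the crux's
content is the range `0 < ε ≤ 1`. [folklore] -/
theorem witness_of_one_lt {ε : ℝ} (hε : 1 < ε) :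
    ∃ (G : Type) (_ : Group G) (_ : Fintype G) (J : Submodule ℂ (G → ℂ)) (X Y Z : Finset G),
      (∀ f ∈ J, ∀ a b : G, (fun g : G => f (a * g * b)) ∈ J) ∧
      (∀ x₀ ∈ X, ∀ z₀ ∈ Z, ∃ f ∈ J, ∀ x ∈ X, ∀ y ∈ Y, ∀ y' ∈ Y, ∀ z ∈ Z,
        (x = x₀ ∧ y = y' ∧ z = z₀ → f (x⁻¹ * y * y'⁻¹ * z) = 1) ∧
        (¬ (x = x₀ ∧ y = y' ∧ z = z₀) → f (x⁻¹ * y * y'⁻¹ * z) = 0)) ∧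
      (∑ᶠ χ ∈ irrChars G ∩ (J : Set (G → ℂ)), (χ 1).re ^ (2 + ε))
        < ((X.card * Y.card * Z.card : ℕ) : ℝ) ^ ((2 + ε) / 3) :=
  ⟨Multiplicative (ZMod 2), inferInstance, inferInstance, ⊤, _, _, _, witnessC2_of_one_lt hε⟩

/-- **Abelian hosts realize the family at `ε` iff `ε > 1`** (`→`: the sibling disprover's
`gradedDesignFamily_no_abelian_witness`, crux 7611, `V ≤ dim J ≤ #(Irr ∩ J)`; `←`: the `Z/2`
design).  Hence for `0 < ε ≤ 1` — the whole content of the crux — hosts must be non-abelian.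
[folklore] -/
theorem exists_abelian_witness_iff {ε : ℝ} (hε : 0 < ε) :
    (∃ (G : Type) (_ : CommGroup G) (_ : Fintype G) (J : Submodule ℂ (G → ℂ)) (X Y Z : Finset G),
      (∀ f ∈ J, ∀ a b : G, (fun g : G => f (a * g * b)) ∈ J) ∧
      (∀ x₀ ∈ X, ∀ z₀ ∈ Z, ∃ f ∈ J, ∀ x ∈ X, ∀ y ∈ Y, ∀ y' ∈ Y, ∀ z ∈ Z,
        (x = x₀ ∧ y = y' ∧ z = z₀ → f (x⁻¹ * y * y'⁻¹ * z) = 1) ∧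
        (¬ (x = x₀ ∧ y = y' ∧ z = z₀) → f (x⁻¹ * y * y'⁻¹ * z) = 0)) ∧
      (∑ᶠ χ ∈ irrChars G ∩ (J : Set (G → ℂ)), (χ 1).re ^ (2 + ε))
        < ((X.card * Y.card * Z.card : ℕ) : ℝ) ^ ((2 + ε) / 3)) ↔ 1 < ε := by
  constructor
  · rintro ⟨G, _, _, J, X, Y, Z, hJ, hsep, hlt⟩
    by_contra hle
    push Not at hle
    exact GradedPricing.Negative.gradedDesignFamily_no_abelian_witness hε hle J hJ X Y Z hsep hlt
  · intro h1
    exact ⟨Multiplicative (ZMod 2), inferInstance, inferInstance, ⊤, _, _, _,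
      witnessC2_of_one_lt h1⟩

end Summit.MatrixMultiplication.MatrixMultiplication.Theorems.GradedDesignFamily.Negative

end
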